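import Summits.BirchSwinnertonDyer.BirchSwinnertonDyer.Theorems.PrintX11aLambdaParityOddMult
import Summits.BirchSwinnertonDyer.BirchSwinnertonDyer.Theorems.ErratumRoadFiveNonSurjCornerTwinTateParameterPow
import Literature.NumberTheory.EllipticCurves.PAdicLFunctionOrderParityProofs
import Literature.NumberTheory.EllipticCurves.AtkinLehnerComplementEigenvalueProofs
import Literature.NumberTheory.EllipticCurves.CuspFormLFunctionLevelConductorProofs
import Literature.NumberTheory.EllipticCurves.Wuthrich2014.IntegralPAdicLFunctionMultiplicative
import Literature.NumberTheory.EllipticCurves.PAdicBSDProofs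
import HarnessLib

/-!
# Route `ErratumRoadFive`, crux 19065 `NonSurjCorner`, child 19948 `NonSurjCornerTwinMuAn`: the PARITY of the
# analytic μ = 0 certificate index on the X11a leaf twins — ODD (hence `≥ 3` on the corner) at a split prime,
# EVEN at a non-split prime (cell `bsd-stepL`, seat `bsd-stepL-corner5-p2` g7; `--supports 19948 --as helper`)

The two registered stubs of 19948's line `Cruxes/NonSurjCornerTwinMuAn/Lines/birth.lean` (`stub_twinMuAn_split`,
`stub_twinMuAn_nonsplit`) ask, for a globally minimal rank-`0` twin `Wd` (`ClassX11a Wd p`, `ρ̄` not onto,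
`p ∈ {5,7}`), for SOME index `n` with `‖[Tⁿ](ϖ·L)‖_p = 1`, `L` THE Mazur–Tate–Teitelbaum function of the newform
`f` of `Wd` at `p ‖ N` (`IsMultPAdicLFunctionOf f p (±1) L`), `ϖ·Ω_{Wd} = Ω⁺_f`. The per-twin certificate is the
LEAST such `n` (= `λ(ϖ·L)` when `ϖ·L ∈ Λ` has `μ = 0`). This file fixes ITS PARITY, class-wide and fact-free up
to modularity, by assembling tree theorems:

* the Mazur–Tate–Teitelbaum functional equation of THE function at `p ‖ N`
  (`IsMultPAdicLFunctionOf.subst_eq_of_atkinLehner`, MTT 1986 §I.17: `L(ι T) = σ (1+T)^c L(T)`, `w_M f = −σ f`,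
  `N = pM`) read on the first unit coefficient at an odd prime
  (`X11a.LambdaParity.neg_one_pow_firstUnitCoeff_eq_sign_of_…`, cell `bsd-print-x11a`: `(−1)^n = σ`);
* the Atkin–Lehner bookkeeping `ε_N = λ(Q_p)·ε_M`, `λ(Q_p) = −a_p`, `w_M f = ε_M f`
  (`AtkinLehnerComplementEigenvalueProofs`, Knapp Thm. 9.27) and Hecke's sign `(−1)^{r_an} = −ε_N`
  (`neg_one_pow_analyticRank_eq_of_hasFunctionalEquationSign`), exactly as in the b2b cell's
  `X2.LambdaParity.exists_sign_eq_neg_one_pow_lam_mult` (there in the `λ(g)` currency of `Λ`; here in the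
  first-unit-coefficient currency of 19948's stubs);
* level `=` conductor for every newform of the twin from modularity (`exists_isNewformOf`, one of the route's
  twenty-three named facts `KatoTwinFactsFiveAn`; `IsNewformOf.level_eq_conductorNorm_of_exists_isNewformOf`).

Results (`W` = the twin; no image hypothesis is needed for the parity law itself):

* §1 `TwinIndexParity.odd_and_even_firstUnitCoeff_of_analyticRank_eq_zero` — `r_an(W) = 0`, `p ≠ 2` multiplicative:
  the first unit coefficient of ANY rescaling `t·L` sits at an ODD index if `p` is split, at an EVEN index if
  `p` is non-split (`σ = −a_p·w_W = −a_p`);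
* §2 the corner corollaries in the binders of the two stubs: `NonSurjTwin.odd_firstUnitCoeff_of_split`,
  `NonSurjTwin.even_firstUnitCoeff_of_nonsplit`; with lane B g6's `NonSurjTwin.two_le_of_norm_coeff_eq_one`
  (p584834: on the corner `q_E` is a `p`-th power, so `[T¹]` is never a unit for `p`-integral `#Ш_an`)
  **`NonSurjTwin.three_le_firstUnitCoeff_of_split`: the split-branch certificate index is `≥ 3`** — `[T²]` is
  never the certificate either; and at a non-split prime a non-unit value `[T⁰]` forces index `≥ 2`
  (`NonSurjTwin.two_le_firstUnitCoeff_of_nonsplit_of_nonunit_value`);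
* §3 the same read on the LEAST witness of the stubs' `∃ n` under Wuthrich's integrality `ϖ·L ∈ Λ`
  (Cor. 18, by name): `Nat.find` is odd and `≥ 3` (split) / even (non-split).

Data (HOME/corner/g6/CERT-TWINMUAN-5.tsv, lane A; this seat's kit j294260–j294270): split corner twins at 5 have
certificate index 3,3,3,3,5,3; non-split twins with a Tamagawa carrier 2,2; carrier-free non-split twins 0.
HONEST FRAMING: theorems only (no definition, no new named fact, no `sorry`); conditional on modularity
(`exists_isNewformOf`) and, in §2–§3 where stated, on GZK / Greenberg–Stevens / Wuthrich Cor. 18 BY NAME; nothing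
here proves a stub, the crux, or BSD for any class (T7) — it constrains the SHAPE of the per-twin certificate.
References: [MazurTateTeitelbaum1986Invent] §I.17–§I.18; [GreenbergLNM1716] §1 pp. 67–68, §5 p. 181;
[Knapp1993] Lemma 9.24, Thm. 9.27; [Wuthrich2014] Cor. 18; [BurungaleSkinner2023] Prop. 2.2 (the good-ordinary twin).
-/

set_option autoImplicit false
set_option linter.dupNamespace false

noncomputable section

open scoped Classical MatrixGroups ModularForm NumberField
open CongruenceSubgroup PowerSeries WeierstrassCurve IsDedekindDomain
  Literature.NumberTheory.EllipticCurves Literature.NumberTheory.EllipticCurves.ModularForms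
  Literature.NumberTheory.EllipticCurves.Rank1Residual Summit.BirchSwinnertonDyer.Rank1Residual
  Summit.BirchSwinnertonDyer.Rank1Residual.X11a.LambdaParity

namespace Summit.BirchSwinnertonDyer.BirchSwinnertonDyer.Theorems.TwinIndexParity

variable {W : WeierstrassCurve ℚ} [W.IsElliptic] {p : ℕ} [Fact p.Prime] {N : ℕ} [NeZero N]
  {f : CuspForm (Gamma0 N) 2}

/-! ### §1 The parity law at an odd multiplicative prime of a rank-`0` curve -/

/-- **The Atkin–Lehner sign of the prime-to-`p` level is `a_p` in analytic rank `0`.** For the newform `f`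
of an elliptic `W/ℚ` at level `N = N_W` with `r_an(W) = 0` and `p ‖ N` (multiplicative): `N = pM`, `p ∤ M`,
and `w_M f = a_p • f` (`ε_N = −1` by Hecke since `(−1)^{r_an} = −ε_N`; `ε_N = λ(Q_p) ε_M`, `λ(Q_p) = −a_p`,
`a_p = ±1`). Output in the shape consumed by the `p`-adic functional equation: `σ := −a_p`, `w_M f = (−σ) • f`.
[cite: Knapp1993, Lemma 9.24 and Thm. 9.27] [cite: MazurTateTeitelbaum1986Invent, §I.17] -/
theorem exists_level_eq_mul_and_atkinLehner_eq_neg_sign_smul (hN : N = W.conductorNorm ℤ)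
    (hr : W.analyticRank = 0) (hmult : W.HasMultiplicativeReductionAtPrime p) (hf : IsNewformOf W f) :
    ∃ (M : ℕ) (_ : NeZero M) (σ : ℤ), N = p * M ∧ ¬ p ∣ M ∧ σ ^ 2 = 1 ∧
      atkinLehnerInvolution N 2 M f = (-(σ : ℂ)) • f ∧
      (W.HasSplitMultiplicativeReductionAtPrime p → σ = -1) ∧
      (¬ W.HasSplitMultiplicativeReductionAtPrime p → σ = 1) := by
  have hpP : p.Prime := Fact.out
  have hf0 : f ≠ 0 := fun h0 ↦ hf.1.coe_ne_zero (by rw [h0]; rfl)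
  -- `a_p = ±1`, `p ∣ N`, `p² ∤ N`
  obtain ⟨a, ha, hap, hpN, has⟩ : ∃ a : ℤ, (a = 1 ∨ a = -1) ∧ cuspCoeff f p = a ∧ p ∣ N ∧
      (W.HasSplitMultiplicativeReductionAtPrime p ↔ a = 1) := by
    by_cases hsplit : W.HasSplitMultiplicativeReductionAtPrime p
    · exact ⟨1, Or.inl rfl, by rw [(hf.cuspCoeff_eq_one_and_sq_of_split hsplit).1, Int.cast_one],
        hf.dvd_level_of_split hsplit, by simp [hsplit]⟩
    · obtain ⟨h1, h2⟩ := hf.cuspCoeff_eq_neg_one_and_dvd_of_nonsplit hmult hsplit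
      exact ⟨-1, Or.inr rfl, by rw [h1]; push_cast; ring, h2, by simp [hsplit]⟩
  have hLp : W.LFunction p ≠ 0 := by
    intro h0
    have e := hf.2 p
    rw [hap, h0] at e
    rcases ha with rfl | rfl <;> norm_num at e
  have hp2 : ¬ p ^ 2 ∣ N := hf.not_sq_dvd_level_of_lFunction_ne_zero hpP hLp
  -- `N = p M`, `p ∤ M`
  obtain ⟨M, hNM⟩ := hpN
  have hpM : ¬ p ∣ M := by
    rintro ⟨M', hM'⟩
    exact hp2 ⟨M', by rw [hNM, hM']; ring⟩
  haveI hM : NeZero M := ⟨fun h0 ↦ NeZero.ne N (by rw [hNM, h0, mul_zero])⟩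
  have hMN : M ∣ N := ⟨p, by rw [hNM, mul_comm]⟩
  have hcop : Nat.Coprime M (N / M) := by
    rw [hNM, Nat.mul_div_cancel _ (NeZero.pos M)]
    exact (Nat.Coprime.symm ((hpP.coprime_iff_not_dvd).mpr hpM))
  -- `w_M f = ε_M f`, `ε_M = ±1`
  set εM : ℂ := ∏ q ∈ M.primeFactors, atkinLehnerEigenvalueAt f q with hεM
  have hWM : atkinLehnerInvolution N 2 M f = εM • f :=
    hf.1.atkinLehnerInvolution_eq_prod_smul_of_level_eq_mul N hpP hNM hpM
  have hεM1 : εM = 1 ∨ εM = -1 :=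
    eq_one_or_eq_neg_one_of_atkinLehnerInvolution_eq_smul N 2 M hMN hcop hf0 hWM
  -- the complex side: `ε_N = λ(Q_p) ε_M = -a ε_M` and `(-1)^{r_an} = -ε_N`, so `ε_M = a`
  have hεN : frickeEigenvalue f = atkinLehnerEigenvalueAt f p * εM :=
    hf.1.frickeEigenvalue_eq_mul_prod_of_level_eq_mul N hpP hNM hpM
  have hlamp : atkinLehnerEigenvalueAt f p = -(a : ℂ) := by
    rw [hf.1.atkinLehnerEigenvalueAt_eq_neg_coeff_of_not_dvd p hNM hpM, ← hap]
    rfl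
  obtain ⟨ε, -, hFr⟩ := IsNewform0.exists_frickeInvolution_eq_smul_of_mainLemma0
    N 2 (atkinLehnerMainLemma0_holds 2 N) hf.1
  have hεeq : ε = frickeEigenvalue f := by
    have h2 := frickeInvolution_eq_frickeEigenvalue_smul ⟨ε, hFr⟩
    rw [hFr] at h2
    have h3 : (ε - frickeEigenvalue f) • f = 0 := by rw [sub_smul, h2, sub_self]
    exact sub_eq_zero.mp ((smul_eq_zero.mp h3).resolve_right hf0)
  -- the `p`-adic sign `σ := -ε_M`
  obtain ⟨σ, hσ1, hσε⟩ : ∃ σ : ℤ, (σ = 1 ∨ σ = -1) ∧ (σ : ℂ) = -εM := by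
    rcases hεM1 with h | h
    · exact ⟨-1, Or.inr rfl, by rw [h]; push_cast; ring⟩
    · exact ⟨1, Or.inl rfl, by rw [h]; push_cast; ring⟩
  have hσsq : σ ^ 2 = 1 := by rcases hσ1 with rfl | rfl <;> norm_num
  have hW' : atkinLehnerInvolution N 2 M f = (-(σ : ℂ)) • f := by rw [hσε, neg_neg]; exact hWM
  -- `w := -ε_N = -(a σ)`; Hecke: `(-1)^{r_an} = w`; `r_an = 0` gives `w = 1`, i.e. `σ = -a`
  set w : ℤ := -(a * σ) with hw
  have hwε : (w : ℂ) = -ε := by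
    rw [hw, hεeq, hεN, hlamp]
    push_cast
    have : (σ : ℂ) = -εM := hσε
    rw [show εM = -(σ : ℂ) by rw [this, neg_neg]]
    ring
  have hE : W.HasEntireLFunction := hf.hasEntireLFunction
  obtain ⟨Λ, hΛ, hfe⟩ := exists_functional_equation_of_frickeInvolution_eq_smul
    (exists_completedCuspFormL_functional_equation_holds N 2) hFr
  subst hN
  have hC : (-1 : ℂ) ^ W.analyticRank = w :=
    neg_one_pow_analyticRank_eq_of_hasFunctionalEquationSign W hE
      (W.hasFunctionalEquationSign_of_isNewformOf hE hf hΛ hfe hwε)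
  rw [hr, pow_zero] at hC
  have hw1 : w = 1 := by exact_mod_cast hC.symm
  have hσa : σ = -a := by
    rcases ha with rfl | rfl <;> rcases hσ1 with rfl | rfl
    · norm_num [hw] at hw1
    · rfl
    · norm_num
    · norm_num [hw] at hw1
  refine ⟨M, hM, σ, hNM, hpM, hσsq, hW', fun hsplit ↦ ?_, fun hns ↦ ?_⟩
  · rw [hσa, has.mp hsplit]
  · rcases ha with h | h
    · exact absurd (has.mpr h) hns
    · rw [hσa, h]; norm_num

/-- **Parity law for the first unit coefficient at an odd multiplicative prime in analytic rank `0`.** Let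
`W/ℚ` be elliptic with `r_an(W) = 0`, `p ≠ 2` of multiplicative reduction, `f` a newform of `W` (at any level —
it is `N_W` by modularity, `hmod`), `L` THE Mazur–Tate–Teitelbaum function at `p` (`IsMultPAdicLFunctionOf f p 1 L`
if split, `… (−1) L` if non-split) and `t ∈ ℚ_p`. If `n` is the index of the first coefficient of `t·L` of norm
`1` (all earlier ones of norm `< 1`), then `n` is ODD when `p` is split (the trivial zero: `σ = −w_W = −1`) and EVEN
when `p` is non-split (`σ = w_W = +1`). [cite: MazurTateTeitelbaum1986Invent, §I.17 and §I.18]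
[cite: GreenbergLNM1716, §1 pp. 67–68 and §5 p. 181] [cite: Knapp1993, Thm. 9.27] -/
theorem odd_and_even_firstUnitCoeff_of_analyticRank_eq_zero (hmod : exists_isNewformOf) (hp2 : p ≠ 2)
    (hr : W.analyticRank = 0) (hmult : W.HasMultiplicativeReductionAtPrime p) (hf : IsNewformOf W f)
    {L : PowerSeries ℚ_[p]}
    (hLs : W.HasSplitMultiplicativeReductionAtPrime p → IsMultPAdicLFunctionOf f p 1 L)
    (hLn : ¬ W.HasSplitMultiplicativeReductionAtPrime p → IsMultPAdicLFunctionOf f p (-1) L)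
    (t : ℚ_[p]) {n : ℕ} (hsmall : ∀ j < n, ‖coeff j (C t * L)‖ < 1) (hunit : ‖coeff n (C t * L)‖ = 1) :
    (W.HasSplitMultiplicativeReductionAtPrime p → Odd n) ∧
      (¬ W.HasSplitMultiplicativeReductionAtPrime p → Even n) := by
  have hN : N = W.conductorNorm ℤ := IsNewformOf.level_eq_conductorNorm_of_exists_isNewformOf hmod hf
  obtain ⟨M, hM, σ, hNM, hpM, hσ, hW, hσs, hσn⟩ :=
    exists_level_eq_mul_and_atkinLehner_eq_neg_sign_smul hN hr hmult hf
  haveI : NeZero M := hM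
  constructor
  · intro hsplit
    have hL : IsSplitMultPAdicLFunctionOf f p L := (isMultPAdicLFunctionOf_one_iff L).mp (hLs hsplit)
    have h := neg_one_pow_firstUnitCoeff_eq_sign_of_isSplitMultPAdicLFunctionOf hp2 hsplit hf hNM hpM hσ
      hW hL t hsmall hunit
    rw [hσs hsplit] at h
    rcases Nat.even_or_odd n with hn | hn
    · exfalso; rw [hn.neg_one_pow] at h; norm_num at h
    · exact hn
  · intro hns
    have h := neg_one_pow_firstUnitCoeff_eq_sign_of_isMultPAdicLFunctionOf_neg_one hp2 hf hmult hns hNM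
      hpM hσ hW (hLn hns) t hsmall hunit
    rw [hσn hns] at h
    rcases Nat.even_or_odd n with hn | hn
    · exact hn
    · exfalso; rw [hn.neg_one_pow] at h; norm_num at h

end Summit.BirchSwinnertonDyer.BirchSwinnertonDyer.Theorems.TwinIndexParity

/-! ### §2 The corner corollaries, in the binders of 19948's registered stubs -/

namespace Summit.BirchSwinnertonDyer.BirchSwinnertonDyer.Theorems.TatePow

open Summit.BirchSwinnertonDyer.BirchSwinnertonDyer.Theorems.TwinIndexParity Rat.HeightOneSpectrum

variable {W : WeierstrassCurve ℚ} [W.IsElliptic] [W.IsGloballyMinimal] {p : ℕ} [Fact p.Prime]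
  {N : ℕ} [NeZero N] {f : CuspForm (Gamma0 N) 2}

/-- **Split corner twin: the certificate index is ODD.** Under the binders of `stub_twinMuAn_split` (19948):
`ClassX11a Wd p` (so `r_an = 0`, `p ≠ 2`, multiplicative), `p` SPLIT, `f` a newform of `Wd`, `L` THE function
(`IsMultPAdicLFunctionOf f p 1 L`), and for every rescaling `t·L` (`t = ϖ` is the stub's): the first index `n` with
`‖[Tⁿ](t·L)‖ = 1` is odd. The image binders `¬Surj`, `p ∈ {5,7}`, `p ∣ ord_p Δ_min` are NOT used (parity is
class-wide on X11a), modularity `exists_isNewformOf` is. [cite: MazurTateTeitelbaum1986Invent, §I.17 and §I.18] -/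
theorem NonSurjTwin.odd_firstUnitCoeff_of_split (hmod : exists_isNewformOf) (hXa : ClassX11a W p)
    (hsplit : W.HasSplitMultiplicativeReductionAtPrime p) (hf : IsNewformOf W f)
    {L : PowerSeries ℚ_[p]} (hL : IsMultPAdicLFunctionOf f p 1 L) (t : ℚ_[p]) {n : ℕ}
    (hsmall : ∀ j < n, ‖coeff j (C t * L)‖ < 1) (hunit : ‖coeff n (C t * L)‖ = 1) : Odd n :=
  (odd_and_even_firstUnitCoeff_of_analyticRank_eq_zero hmod hXa.2.1 hXa.1 hXa.2.2.1 hf (fun _ ↦ hL)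
    (fun h ↦ absurd hsplit h) t hsmall hunit).1 hsplit

/-- **Non-split corner twin: the certificate index is EVEN** (binders of `stub_twinMuAn_nonsplit`, 19948; THE
non-split function `IsMultPAdicLFunctionOf f p (−1) L`): the first index `n` with `‖[Tⁿ](t·L)‖ = 1` is even — so
either the VALUE `[T⁰] = 2ϖ[0]⁺_f` is a unit (`n = 0`, corner-p1 g7 p499490 / lane B g6 p583299) or `n ≥ 2`.
[cite: MazurTateTeitelbaum1986Invent, §I.17 and §I.18] -/
theorem NonSurjTwin.even_firstUnitCoeff_of_nonsplit (hmod : exists_isNewformOf) (hXa : ClassX11a W p)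
    (hns : ¬ W.HasSplitMultiplicativeReductionAtPrime p) (hf : IsNewformOf W f)
    {L : PowerSeries ℚ_[p]} (hL : IsMultPAdicLFunctionOf f p (-1) L) (t : ℚ_[p]) {n : ℕ}
    (hsmall : ∀ j < n, ‖coeff j (C t * L)‖ < 1) (hunit : ‖coeff n (C t * L)‖ = 1) : Even n :=
  (odd_and_even_firstUnitCoeff_of_analyticRank_eq_zero hmod hXa.2.1 hXa.1 hXa.2.2.1 hf
    (fun h ↦ absurd h hns) (fun _ ↦ hL) t hsmall hunit).2 hns

/-- **Non-split corner twin with a NON-unit value: the certificate index is `≥ 2`** (even and `≠ 0`): if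
`‖[T⁰](t·L)‖ < 1` — e.g. `p ∣ #Ш(Wd)_an·∏c(Wd)` (lane B g6 p583299: `ϖ[0]⁺ = #Ш_an·∏c/#tors²`) — then the
first unit coefficient sits at an even index `n ≥ 2`. [cite: MazurTateTeitelbaum1986Invent, §I.17 and §I.18] -/
theorem NonSurjTwin.two_le_firstUnitCoeff_of_nonsplit_of_nonunit_value (hmod : exists_isNewformOf)
    (hXa : ClassX11a W p) (hns : ¬ W.HasSplitMultiplicativeReductionAtPrime p) (hf : IsNewformOf W f)
    {L : PowerSeries ℚ_[p]} (hL : IsMultPAdicLFunctionOf f p (-1) L) (t : ℚ_[p]) {n : ℕ}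
    (hsmall : ∀ j < n, ‖coeff j (C t * L)‖ < 1) (hunit : ‖coeff n (C t * L)‖ = 1)
    (h0 : ‖coeff 0 (C t * L)‖ < 1) : 2 ≤ n ∧ Even n := by
  have hev := NonSurjTwin.even_firstUnitCoeff_of_nonsplit hmod hXa hns hf hL t hsmall hunit
  refine ⟨?_, hev⟩
  rcases Nat.lt_or_ge n 2 with hlt | hge
  · exfalso
    interval_cases n
    · rw [hunit] at h0; exact lt_irrefl _ h0
    · exact absurd hev (by decide)
  · exact hge

/-- **Split corner twin: the certificate index is `≥ 3` and odd** — `[T⁰] = 0` (trivial zero), `[T¹]` is never a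
unit on the corner for `p`-integral `#Ш(Wd)_an` (lane B g6 p583928 + p584834: `‖[T¹](ϖL)‖ ≤ ‖#Ш_an‖/p` because the
corner's Tate parameter is a `p`-th power; GZK + Greenberg–Stevens BY NAME, `p` the only split place), and `[T²]`
is excluded by PARITY (§1). Binders = those of `NonSurjTwin.two_le_of_norm_coeff_eq_one` + the stub's split binder + `hsmall` + modularity.
[cite: MazurTateTeitelbaum1986Invent, §I.15, §I.17 and §I.18] [cite: SkinnerZhang2014, Thm. 1.3 (c)] -/
theorem NonSurjTwin.three_le_firstUnitCoeff_of_split (hmod : exists_isNewformOf)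
    (hGZK : rank_eq_analyticRank_of_analyticRank_le_one) (hXa : ClassX11a W p) (hnsj : ¬ Surj W p)
    (h57 : p = 5 ∨ p = 7) (hsplit : W.HasSplitMultiplicativeReductionAtPrime p) (hGS : greenberg_stevens (W := W) (p := p)) (Dq : TateParameterData W p)
    (huniq : ∀ v : HeightOneSpectrum (𝓞 ℚ), W.HasSplitMultiplicativeReductionAt v →
      v = (Rat.HeightOneSpectrum.primesEquiv (R := 𝓞 ℚ)).symm ⟨p, Fact.out⟩)
    (hf : IsNewformOf W f) {ϖ : ℚ} (hϖ : (ϖ : ℝ) * W.realPeriodRat = plusPeriod f)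
    {L : PowerSeries ℚ_[p]} (hL : IsMultPAdicLFunctionOf f p 1 L) {q : ℚ} (hq : shaAn W = (q : ℂ)) (hq0 : q ≠ 0)
    (hint : 0 ≤ padicValRat p q) {n : ℕ}
    (hsmall : ∀ j < n, ‖PowerSeries.coeff j (PowerSeries.C ((ϖ : ℚ) : ℚ_[p]) * L)‖ < 1)
    (hn : ‖PowerSeries.coeff n (PowerSeries.C ((ϖ : ℚ) : ℚ_[p]) * L)‖ = 1) : 3 ≤ n ∧ Odd n := by
  have h2 := NonSurjTwin.two_le_of_norm_coeff_eq_one hGZK hXa hnsj h57 hGS Dq huniq hf hϖ hL hq hq0 hint hn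
  have hodd := NonSurjTwin.odd_firstUnitCoeff_of_split hmod hXa hsplit hf hL ((ϖ : ℚ) : ℚ_[p]) hsmall hn
  refine ⟨?_, hodd⟩
  rcases Nat.lt_or_ge n 3 with hlt | hge
  · exfalso
    have h2n : n = 2 := by omega
    rw [h2n] at hodd
    exact absurd hodd (by decide)
  · exact hge

/-! ### §3 The LEAST witness of the stubs' `∃ n`, under Wuthrich's integrality `ϖ·L ∈ Λ` (Cor. 18, by name) -/

/-- Under `ϖ·L ∈ Λ` every coefficient has norm `≤ 1`, so below the least unit coefficient all norms are `< 1`.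
[cite: Wuthrich2014, Cor. 18 (p. 398)] -/
theorem NonSurjTwin.norm_coeff_lt_one_of_lt_find {L' : PowerSeries ℚ_[p]} (hint : ∀ k, ‖coeff k L'‖ ≤ 1)
    (h : ∃ n, ‖coeff n L'‖ = 1) (j : ℕ) (hj : j < Nat.find h) : ‖coeff j L'‖ < 1 :=
  lt_of_le_of_ne (hint j) (Nat.find_min h hj)

/-- **Split corner twin, least witness: `Nat.find` of `stub_twinMuAn_split`'s `∃ n` is ODD**, granted Wuthrich 2014
Cor. 18 BY NAME (`hWu`: `ϖ·L = ι G`, `G ∈ Λ`) and modularity (`hmod`). [cite: Wuthrich2014, Cor. 18 (p. 398)]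
[cite: MazurTateTeitelbaum1986Invent, §I.17 and §I.18] -/
theorem NonSurjTwin.odd_find_of_split
    (hWu : Wuthrich2014.corollary18_padicLFunction_mem_iwasawaAlgebra_multiplicative) (hmod : exists_isNewformOf)
    (hXa : ClassX11a W p) (hsplit : W.HasSplitMultiplicativeReductionAtPrime p) (hf : IsNewformOf W f) {ϖ : ℚ}
    (hϖ : (ϖ : ℝ) * W.realPeriodRat = plusPeriod f) {L : PowerSeries ℚ_[p]} (hL : IsMultPAdicLFunctionOf f p 1 L)
    (h : ∃ n : ℕ, ‖PowerSeries.coeff n (PowerSeries.C ((ϖ : ℚ) : ℚ_[p]) * L)‖ = 1) : Odd (Nat.find h) := by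
  obtain ⟨G, hG⟩ := (hWu W p hXa.2.1 hXa.2.2.1 hf ϖ hϖ).2 hsplit L ((isMultPAdicLFunctionOf_one_iff L).mp hL)
  have hint := (exists_iwasawaToPowerSeries_eq_iff_norm_coeff_le_one _).mp ⟨G, hG⟩
  exact NonSurjTwin.odd_firstUnitCoeff_of_split hmod hXa hsplit hf hL _
    (NonSurjTwin.norm_coeff_lt_one_of_lt_find hint h) (Nat.find_spec h)

/-- **Non-split corner twin, least witness: `Nat.find` of `stub_twinMuAn_nonsplit`'s `∃ n` is EVEN**, granted
Wuthrich 2014 Cor. 18 BY NAME and modularity. [cite: Wuthrich2014, Cor. 18 (p. 398)]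
[cite: MazurTateTeitelbaum1986Invent, §I.17 and §I.18] -/
theorem NonSurjTwin.even_find_of_nonsplit
    (hWu : Wuthrich2014.corollary18_padicLFunction_mem_iwasawaAlgebra_multiplicative) (hmod : exists_isNewformOf)
    (hXa : ClassX11a W p) (hns : ¬ W.HasSplitMultiplicativeReductionAtPrime p) (hf : IsNewformOf W f) {ϖ : ℚ}
    (hϖ : (ϖ : ℝ) * W.realPeriodRat = plusPeriod f) {L : PowerSeries ℚ_[p]}
    (hL : IsMultPAdicLFunctionOf f p (-1) L)
    (h : ∃ n : ℕ, ‖PowerSeries.coeff n (PowerSeries.C ((ϖ : ℚ) : ℚ_[p]) * L)‖ = 1) : Even (Nat.find h) := by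
  obtain ⟨G, hG⟩ := (hWu W p hXa.2.1 hXa.2.2.1 hf ϖ hϖ).1 hns L hL
  have hint := (exists_iwasawaToPowerSeries_eq_iff_norm_coeff_le_one _).mp ⟨G, hG⟩
  exact NonSurjTwin.even_firstUnitCoeff_of_nonsplit hmod hXa hns hf hL _
    (NonSurjTwin.norm_coeff_lt_one_of_lt_find hint h) (Nat.find_spec h)

/-- **Split corner twin, least witness `≥ 3`**: with the binders of lane B g6's `NonSurjTwin.two_le_of_norm_coeff_eq_one`
(GZK, Greenberg–Stevens, the Tate datum, `p` the only split place, `shaAn Wd = q` `p`-integral) plus Wuthrich Cor. 18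
and modularity by name, the least witness of `stub_twinMuAn_split`'s `∃ n` satisfies `3 ≤ Nat.find h` and is odd —
the per-twin certificate of 19948's split branch reads `[T³]` or deeper. [cite: Wuthrich2014, Cor. 18 (p. 398)]
[cite: MazurTateTeitelbaum1986Invent, §I.15, §I.17 and §I.18] -/
theorem NonSurjTwin.three_le_find_of_split
    (hWu : Wuthrich2014.corollary18_padicLFunction_mem_iwasawaAlgebra_multiplicative) (hmod : exists_isNewformOf)
    (hGZK : rank_eq_analyticRank_of_analyticRank_le_one) (hXa : ClassX11a W p) (hnsj : ¬ Surj W p)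
    (h57 : p = 5 ∨ p = 7) (hsplit : W.HasSplitMultiplicativeReductionAtPrime p)
    (hGS : greenberg_stevens (W := W) (p := p)) (Dq : TateParameterData W p)
    (huniq : ∀ v : HeightOneSpectrum (𝓞 ℚ), W.HasSplitMultiplicativeReductionAt v →
      v = (Rat.HeightOneSpectrum.primesEquiv (R := 𝓞 ℚ)).symm ⟨p, Fact.out⟩)
    (hf : IsNewformOf W f) {ϖ : ℚ} (hϖ : (ϖ : ℝ) * W.realPeriodRat = plusPeriod f)
    {L : PowerSeries ℚ_[p]} (hL : IsMultPAdicLFunctionOf f p 1 L) {q : ℚ} (hq : shaAn W = (q : ℂ)) (hq0 : q ≠ 0)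
    (hint : 0 ≤ padicValRat p q)
    (h : ∃ n : ℕ, ‖PowerSeries.coeff n (PowerSeries.C ((ϖ : ℚ) : ℚ_[p]) * L)‖ = 1) :
    3 ≤ Nat.find h ∧ Odd (Nat.find h) := by
  obtain ⟨G, hG⟩ := (hWu W p hXa.2.1 hXa.2.2.1 hf ϖ hϖ).2 hsplit L ((isMultPAdicLFunctionOf_one_iff L).mp hL)
  have hle := (exists_iwasawaToPowerSeries_eq_iff_norm_coeff_le_one _).mp ⟨G, hG⟩
  exact NonSurjTwin.three_le_firstUnitCoeff_of_split hmod hGZK hXa hnsj h57 hsplit hGS Dq huniq hf hϖ hL hq hq0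
    hint (NonSurjTwin.norm_coeff_lt_one_of_lt_find hle h) (Nat.find_spec h)

end Summit.BirchSwinnertonDyer.BirchSwinnertonDyer.Theorems.TatePow

end
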